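import Mathlib
import Summits.Ventures.PercRepro2.Defs
import Summits.Ventures.PercRepro2.Graph
import Summits.Ventures.PercRepro2.Induced
import Summits.Ventures.PercRepro2.VdBKahn
import Summits.Ventures.PercRepro2.ReimerVdBK
import Summits.Ventures.PercRepro2.ReimerVdBKRegions
import Summits.Ventures.PercRepro2.ReimerVdBKFlip

/-!
# (R-1.2) on the trivial-core stratum
(blind cell PercRepro2, mine-c g44; `conjectures/MINE-C.md` §53.4)

THEOREM (`count_twoWorld_trivialCore_le`): for every `(A, X, B, Y)`,
  `#{ω ∈ L : K₁ ∩ K₂ = {s}} ≤ #{ω ∈ R : K₁ ∩ K₂ = {s}}`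
with `L = twoWorld A X B Y`, `R = twoWorld (A ∪ B) (X ∩ Y) ∅ (X ∪ Y)` — the conjecture `(R-1.2)` holds
stratum by stratum on the configurations whose two clusters meet only at the root.  This contains the
tree case (`rvdBK_of_rootLeaf`: on a tree the core is always `{s}`), and it is the first stratum of the
core-convolution of `MINE-C.md` §53.4 (a); the C-conditional statement fails from `|K₁ ∩ K₂| = 2` on.

PROOF. The component flip `Ψ ω = flipAt D ω` with `D = hitSet (K₂ \ K₁) (B ∪ X)` (the union of the
components of the graph induced on the world-2-private region that meet `B ∪ X`) maps `L` into `R`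
(`flipAt_mem_twoWorld`).  On the trivial-core stratum world 2 loses EXACTLY `D` (`K₂_flipAt_of_trivialCore`:
the only vertex of `K₂` outside `D` adjacent to `D` is the root), so the stratum is preserved and the
world-1-private region of the image is `(K₁ \ K₂) ∪ D`.  Since no vertex of `B ∪ X` lies in `K₁ \ K₂`
for `ω ∈ L` and there is no edge between the private regions, `D` is recovered from the image as
`hitSet (K₁ \ K₂)(Ψ ω) (B ∪ X)`, and `flipAt D` is an involution: `Ψ` is injective on `L ∩ stratum`.
-/

namespace Summit.Ventures.PercRepro2

namespace ReimerVdBK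

open Classical

variable {V : Type*} {E : Type*} [Fintype E] [DecidableEq E] [Fintype V] [DecidableEq V]

variable (ends : E → Sym2 V) (s : V)

/-! ## Connectivity in an induced subgraph of the underlying graph -/

/-- All edges open. -/
def allOpen : Config E := fun _ => true

/-- `u` and `v` are joined by a path of the underlying graph inside the vertex set `S`. -/
def GConn (S : Set V) (u v : V) : Prop := Conn ends (induced ends S (allOpen (E := E))) u v

omit [Fintype E] [DecidableEq E] [Fintype V] [DecidableEq V] in
/-- `G[S]`-connectivity is reflexive. -/
lemma gconn_refl {S : Set V} (u : V) : GConn ends S u u := conn_refl _ _ u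

omit [Fintype E] [DecidableEq E] [Fintype V] [DecidableEq V] in
/-- `G[S]`-connectivity is symmetric. -/
lemma gconn_symm {S : Set V} {u v : V} (h : GConn ends S u v) : GConn ends S v u := conn_symm h

omit [Fintype E] [DecidableEq E] [Fintype V] [DecidableEq V] in
/-- `G[S]`-connectivity is transitive. -/
lemma gconn_trans {S : Set V} {u v w : V} (h₁ : GConn ends S u v) (h₂ : GConn ends S v w) :
    GConn ends S u w := conn_trans h₁ h₂

omit [Fintype E] [DecidableEq E] [Fintype V] [DecidableEq V] in
/-- An edge inside `S` joins its endpoints in `G[S]`. -/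
lemma gconn_of_edge {S : Set V} {e : E} {x y : V} (hends : ends e = s(x, y)) (hx : x ∈ S)
    (hy : y ∈ S) : GConn ends S x y := by
  refine conn_of_openAdj ⟨e, ?_, hends⟩
  exact induced_eq_true_iff.2 ⟨rfl, x, hx, y, hy, hends⟩

omit [Fintype E] [DecidableEq E] [Fintype V] [DecidableEq V] in
/-- Vertices reachable in `G[S]` from a vertex of `S` lie in `S`. -/
lemma mem_of_gconn {S : Set V} {u v : V} (hu : u ∈ S) (h : GConn ends S u v) : v ∈ S :=
  mem_of_conn_induced hu h

omit [Fintype E] [DecidableEq E] [Fintype V] [DecidableEq V] in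
/-- **A path of `G[S]` starting in a set closed under `G[S]`-adjacency stays there**: if `S' ⊆ S` is
closed under adjacency inside `S` and `u ∈ S'`, then `G[S]`-connectivity from `u` is `G[S']`-connectivity. -/
lemma gconn_of_closed {S S' : Set V}
    (hcl : ∀ e x y, ends e = s(x, y) → x ∈ S' → y ∈ S → y ∈ S') {u v : V} (hu : u ∈ S')
    (h : GConn ends S u v) : GConn ends S' u v := by
  -- the set of vertices `G[S']`-connected to `u` is closed under `G[S]`-adjacency
  have hclosed : ∀ x ∈ {x | GConn ends S' u x}, ∀ y,
      (openGraph ends (induced ends S (allOpen (E := E)))).Adj x y → y ∈ {x | GConn ends S' u x} := by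
    intro x hx y hxy
    obtain ⟨-, e, he, hends⟩ := openGraph_adj.1 hxy
    have hxS' : x ∈ S' := mem_of_gconn ends hu hx
    have hyS : y ∈ S := (mem_and_mem_of_induced_eq_true he hends).2
    have hyS' : y ∈ S' := hcl e x y hends hxS' hyS
    exact gconn_trans ends hx (gconn_of_edge ends hends hxS' hyS')
  exact mem_of_conn_of_closed hclosed (gconn_refl ends u) h

omit [Fintype E] [DecidableEq E] [Fintype V] [DecidableEq V] in
/-- Connectivity inside a smaller set is connectivity inside a larger one. -/
lemma gconn_mono {S S' : Set V} (h : S' ⊆ S) {u v : V} (hc : GConn ends S' u v) :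
    GConn ends S u v :=
  conn_mono (induced_mono_set h _) hc

/-! ## The part of a region hit by a marked set -/

/-- The union of the components of `G[S]` that meet `M`. -/
def hitSet (S : Set V) (M : Finset V) : Set V := {v ∈ S | ∃ w ∈ M, w ∈ S ∧ GConn ends S v w}

omit [Fintype E] [DecidableEq E] [Fintype V] [DecidableEq V] in
/-- The hit set lies in `S`. -/
lemma hitSet_subset (S : Set V) (M : Finset V) : hitSet ends S M ⊆ S := fun _ h => h.1

omit [Fintype E] [DecidableEq E] [Fintype V] [DecidableEq V] in
/-- A vertex of `M ∩ S` lies in the hit set. -/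
lemma mem_hitSet_of_mem {S : Set V} {M : Finset V} {v : V} (hv : v ∈ M) (hS : v ∈ S) :
    v ∈ hitSet ends S M := ⟨hS, v, hv, hS, gconn_refl ends v⟩

omit [Fintype E] [DecidableEq E] [Fintype V] [DecidableEq V] in
/-- A `G[S]`-path from a vertex of the hit set stays in the hit set. -/
lemma mem_hitSet_of_gconn {S : Set V} {M : Finset V} {u v : V} (hu : u ∈ hitSet ends S M)
    (h : GConn ends S u v) : v ∈ hitSet ends S M := by
  obtain ⟨huS, w, hw, hwS, huw⟩ := hu
  exact ⟨mem_of_gconn ends huS h, w, hw, hwS, gconn_trans ends (gconn_symm ends h) huw⟩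

omit [Fintype E] [DecidableEq E] [Fintype V] [DecidableEq V] in
/-- The hit set is closed under adjacency inside `S`. -/
lemma hitSet_closed {S : Set V} {M : Finset V} {e : E} {x y : V} (hends : ends e = s(x, y))
    (hx : x ∈ hitSet ends S M) (hy : y ∈ S) : y ∈ hitSet ends S M :=
  mem_hitSet_of_gconn ends hx (gconn_of_edge ends hends hx.1 hy)

/-! ## The trivial-core stratum -/

/-- The stratum `K₁ ∩ K₂ = {s}`. -/
def trivialCore (ω : Config E) : Prop := core ends s ω = {s}

omit [Fintype E] [DecidableEq E] [Fintype V] [DecidableEq V] in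
/-- On the stratum a vertex of both worlds is the root. -/
lemma eq_root_of_trivialCore {ω : Config E} (h : trivialCore ends s ω) {v : V}
    (h1 : v ∈ K₁ ends s ω) (h2 : v ∈ K₂ ends s ω) : v = s := by
  have : v ∈ core ends s ω := ⟨h1, h2⟩
  rw [trivialCore] at h
  rw [h] at this
  exact this

section Stratum

variable {ω : Config E} {D : Set V}

omit [Fintype E] [DecidableEq E] [Fintype V] [DecidableEq V] in
/-- **World 2 loses exactly the flipped part on the trivial-core stratum**:
`K₂ (flipAt D ω) = K₂ ω \ D` when `K₁ ∩ K₂ = {s}`, `D ⊆ K₂ \ K₁` is closed in `K₂ \ K₁`. -/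
theorem K₂_flipAt_of_trivialCore (htc : trivialCore ends s ω) (hD : D ⊆ only2 ends s ω)
    (hcl : ∀ e x y, ends e = s(x, y) → x ∈ D → y ∉ D → y ∉ only2 ends s ω) :
    K₂ ends s (flipAt ends D ω) = K₂ ends s ω \ D := by
  refine Set.Subset.antisymm (K₂_flipAt_subset ends s hD hcl) ?_
  -- `K₂ (flip) ∪ D` is closed under open adjacency in world 2 of `ω`
  have hclosed : ∀ x ∈ K₂ ends s (flipAt ends D ω) ∪ D, ∀ y,
      (openGraph ends (compl ω)).Adj x y → y ∈ K₂ ends s (flipAt ends D ω) ∪ D := by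
    intro x hx y hxy
    obtain ⟨-, e, he, hends⟩ := openGraph_adj.1 hxy
    have he0 : ω e = false := by simpa [compl] using he
    by_cases hyD : y ∈ D
    · exact Or.inr hyD
    rcases hx with hx | hx
    · by_cases ht : e ∈ touches ends D
      · -- `x ∉ D` (it is in world 2 of the flip), so `y ∈ D`: contradiction
        have hxD : x ∉ D := fun h => ((K₂_flipAt_subset ends s hD hcl) hx).2 h
        exact absurd (mem_of_touches_of_not_mem ends ht hends hxD) hyD
      · have he0' : flipAt ends D ω e = false := by rw [flipAt_of_not_mem ends (ω := ω) ht]; exact he0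
        have he' : compl (flipAt ends D ω) e = true := by simp [compl, he0']
        exact Or.inl (mem_K₁_of_open ends s (ω := compl (flipAt ends D ω)) hx he' hends)
    · -- `x ∈ D`, `y ∉ D`, blue edge: `y ∈ K₂`, and by closedness `y ∈ K₁`, so `y = s`
      have hy2 : y ∈ K₂ ends s ω := mem_K₂_of_closed ends s (mem_K₂_of_mem_D ends s hD hx) he0 hends
      have hy1 : y ∈ K₁ ends s ω := by
        have hno := hcl e x y hends hx hyD
        by_contra hy1
        exact hno ((mem_only2 ends s).2 ⟨hy2, hy1⟩)
      have hys : y = s := eq_root_of_trivialCore ends s htc hy1 hy2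
      rw [hys]
      exact Or.inl (root_mem_K₂ ends s _)
  intro v hv
  have hvT : v ∈ K₂ ends s (flipAt ends D ω) ∪ D :=
    mem_of_conn_of_closed hclosed (Or.inl (root_mem_K₂ ends s _)) hv.1
  rcases hvT with h | h
  · exact h
  · exact absurd h hv.2

omit [Fintype E] [DecidableEq E] [Fintype V] [DecidableEq V] in
/-- The stratum is preserved by the flip. -/
theorem trivialCore_flipAt (htc : trivialCore ends s ω) (hD : D ⊆ only2 ends s ω)
    (hcl : ∀ e x y, ends e = s(x, y) → x ∈ D → y ∉ D → y ∉ only2 ends s ω) :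
    trivialCore ends s (flipAt ends D ω) := by
  unfold trivialCore core
  rw [K₁_flipAt ends s hD hcl, K₂_flipAt_of_trivialCore ends s htc hD hcl]
  ext v
  simp only [Set.mem_inter_iff, Set.mem_union, Set.mem_sdiff, Set.mem_singleton_iff]
  constructor
  · rintro ⟨h1 | h1, h2, h3⟩
    · exact eq_root_of_trivialCore ends s htc h1 h2
    · exact absurd h1 h3
  · intro hv
    rw [hv]
    exact ⟨Or.inl (root_mem_K₁ ends s ω), root_mem_K₂ ends s ω,
      fun h => not_mem_K₁_of_mem_D ends s hD h (root_mem_K₁ ends s ω)⟩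

omit [Fintype E] [DecidableEq E] [Fintype V] [DecidableEq V] in
/-- The world-1-private region of the flip is the old one together with the flipped part. -/
theorem only1_flipAt (htc : trivialCore ends s ω) (hD : D ⊆ only2 ends s ω)
    (hcl : ∀ e x y, ends e = s(x, y) → x ∈ D → y ∉ D → y ∉ only2 ends s ω) :
    only1 ends s (flipAt ends D ω) = only1 ends s ω ∪ D := by
  unfold only1
  rw [K₁_flipAt ends s hD hcl, K₂_flipAt_of_trivialCore ends s htc hD hcl]
  ext v
  simp only [Set.mem_sdiff, Set.mem_union, not_and, not_not]
  constructor
  · rintro ⟨h1 | h1, h2⟩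
    · by_cases hvD : v ∈ D
      · exact Or.inr hvD
      · exact Or.inl ⟨h1, fun h => hvD (h2 h)⟩
    · exact Or.inr h1
  · rintro (⟨h1, h2⟩ | h)
    · exact ⟨Or.inl h1, fun h => absurd h h2⟩
    · exact ⟨Or.inr h, fun _ => h⟩

end Stratum

/-! ## The component flip of a configuration and its inverse -/

section Injection

variable (B X : Finset V)

/-- The flip set of `ω`: the components of the world-2-private region meeting `B ∪ X`. -/
def flipSet (ω : Config E) : Set V := hitSet ends (only2 ends s ω) (B ∪ X)

/-- The component flip `Ψ`. -/
noncomputable def Ψ (ω : Config E) : Config E := flipAt ends (flipSet ends s B X ω) ω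

omit [Fintype E] [DecidableEq E] [Fintype V] in
/-- The flip set lies in the world-2-private region. -/
lemma flipSet_subset (ω : Config E) : flipSet ends s B X ω ⊆ only2 ends s ω :=
  hitSet_subset ends _ _

omit [Fintype E] [DecidableEq E] [Fintype V] in
/-- The flip set is closed in the world-2-private region. -/
lemma flipSet_closed (ω : Config E) :
    ∀ e x y, ends e = s(x, y) → x ∈ flipSet ends s B X ω → y ∉ flipSet ends s B X ω →
      y ∉ only2 ends s ω :=
  fun _ _ _ h hx hy hy2 => hy (hitSet_closed ends h hx hy2)

omit [Fintype E] [DecidableEq E] [Fintype V] in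
/-- Every vertex of `B ∪ X` in the world-2-private region lies in the flip set. -/
lemma mem_flipSet (ω : Config E) :
    ∀ v ∈ B ∪ X, v ∈ only2 ends s ω → v ∈ flipSet ends s B X ω :=
  fun _ hv h2 => mem_hitSet_of_mem ends hv h2

omit [Fintype E] [DecidableEq E] [Fintype V] in
/-- `Ψ` maps the left event of `(R-1.2)` into the right one. -/
theorem Ψ_mem_twoWorld {A Y : Finset V} {ω : Config E} (hω : ω ∈ twoWorld ends s A X B Y) :
    Ψ ends s B X ω ∈ twoWorld ends s (A ∪ B) (X ∩ Y) ∅ (X ∪ Y) :=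
  flipAt_mem_twoWorld ends s hω (flipSet_subset ends s B X ω) (flipSet_closed ends s B X ω)
    (mem_flipSet ends s B X ω)

omit [Fintype E] [DecidableEq E] [Fintype V] in
/-- `Ψ` preserves the trivial-core stratum. -/
theorem trivialCore_Ψ {ω : Config E} (htc : trivialCore ends s ω) :
    trivialCore ends s (Ψ ends s B X ω) :=
  trivialCore_flipAt ends s htc (flipSet_subset ends s B X ω) (flipSet_closed ends s B X ω)

omit [Fintype E] [DecidableEq E] [Fintype V] [DecidableEq V] in
/-- Flipping twice at the same set is the identity. -/
lemma flipAt_flipAt (D : Set V) (ω : Config E) : flipAt ends D (flipAt ends D ω) = ω := by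
  funext e
  by_cases h : e ∈ touches ends D <;> simp [flipAt, h]

omit [Fintype E] [DecidableEq E] [Fintype V] in
/-- **The flip set is recovered from the image**: for `ω ∈ L` on the stratum, the components of the
world-1-private region of `Ψ ω` meeting `B ∪ X` are exactly the flipped components. -/
theorem hitSet_only1_Ψ {A Y : Finset V} {ω : Config E} (htc : trivialCore ends s ω)
    (hω : ω ∈ twoWorld ends s A X B Y) :
    hitSet ends (only1 ends s (Ψ ends s B X ω)) (B ∪ X) = flipSet ends s B X ω := by
  set D := flipSet ends s B X ω with hDdef
  have hD := flipSet_subset ends s B X ω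
  have hcl := flipSet_closed ends s B X ω
  have h1 : only1 ends s (Ψ ends s B X ω) = only1 ends s ω ∪ D := only1_flipAt ends s htc hD hcl
  rw [mem_twoWorld_iff] at hω
  obtain ⟨hA, hX, hB, hY⟩ := hω
  -- no vertex of `B ∪ X` lies in the world-1-private region of `ω`
  have hBX : ∀ w ∈ B ∪ X, w ∉ only1 ends s ω := by
    intro w hw hw1
    rcases Finset.mem_union.1 hw with hw | hw
    · exact ((mem_only1 ends s).1 hw1).2 (hB w hw)
    · exact hX w hw ((mem_only1 ends s).1 hw1).1
  -- `D` is closed under adjacency inside `only1 ω ∪ D` (no edge between the private regions)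
  have hclD : ∀ e x y, ends e = s(x, y) → x ∈ D → y ∈ only1 ends s ω ∪ D → y ∈ D := by
    intro e x y hends hx hy
    rcases hy with hy | hy
    · exfalso
      exact not_adj_only1_only2 ends s hy (hD hx) e (by rw [hends, Sym2.eq_swap])
    · exact hy
  rw [h1]
  ext v
  constructor
  · rintro ⟨hv, w, hw, hwS, hvw⟩
    have hwD : w ∈ D := by
      rcases hwS with hwS | hwS
      · exact absurd hwS (hBX w hw)
      · exact hwS
    have hwv : GConn ends (only1 ends s ω ∪ D) w v := gconn_symm ends hvw
    exact mem_of_gconn ends hwD (gconn_of_closed ends hclD hwD hwv)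
  · intro hv
    have hvD : v ∈ D := hv
    obtain ⟨hv2, w, hw, hw2, hvw⟩ := hv
    have hwD : w ∈ D := mem_hitSet_of_mem ends hw hw2
    have hclD' : ∀ e x y, ends e = s(x, y) → x ∈ D → y ∈ only2 ends s ω → y ∈ D :=
      fun _ _ _ hends hx hy => hitSet_closed ends hends hx hy
    have hvwD : GConn ends D v w := gconn_of_closed ends hclD' hvD hvw
    exact ⟨Or.inr hvD, w, hw, Or.inr hwD, gconn_mono ends Set.subset_union_right hvwD⟩

omit [Fintype E] [DecidableEq E] [Fintype V] in
/-- **`Ψ` is injective on `L ∩ stratum`.** -/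
theorem Ψ_injOn {A Y : Finset V} {ω ω' : Config E} (htc : trivialCore ends s ω)
    (hω : ω ∈ twoWorld ends s A X B Y) (htc' : trivialCore ends s ω')
    (hω' : ω' ∈ twoWorld ends s A X B Y) (h : Ψ ends s B X ω = Ψ ends s B X ω') : ω = ω' := by
  have hD : flipSet ends s B X ω = flipSet ends s B X ω' := by
    rw [← hitSet_only1_Ψ ends s B X htc hω, ← hitSet_only1_Ψ ends s B X htc' hω', h]
  calc ω = flipAt ends (flipSet ends s B X ω) (Ψ ends s B X ω) := (flipAt_flipAt ends _ ω).symm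
    _ = flipAt ends (flipSet ends s B X ω') (Ψ ends s B X ω') := by rw [hD, h]
    _ = ω' := flipAt_flipAt ends _ ω'

end Injection

/-! ## The stratum inequality -/

omit [Fintype V] in
/-- Counting as a cardinality. -/
lemma count_eq_card (S : Set (Config E)) :
    count S = (Finset.univ.filter (fun ω : Config E => ω ∈ S)).card := by
  unfold count
  rw [Finset.card_filter]

omit [Fintype V] in
/-- **(R-1.2) on the trivial-core stratum**: for every `(A, X, B, Y)`,
`#{ω ∈ twoWorld A X B Y : K₁ ∩ K₂ = {s}} ≤ #{ω ∈ twoWorld (A ∪ B) (X ∩ Y) ∅ (X ∪ Y) : K₁ ∩ K₂ = {s}}`. -/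
theorem count_twoWorld_trivialCore_le (A X B Y : Finset V) :
    count (twoWorld ends s A X B Y ∩ {ω | trivialCore ends s ω}) ≤
      count (twoWorld ends s (A ∪ B) (X ∩ Y) ∅ (X ∪ Y) ∩ {ω | trivialCore ends s ω}) := by
  rw [count_eq_card, count_eq_card]
  refine Finset.card_le_card_of_injOn (Ψ ends s B X) ?_ ?_
  · intro ω hω
    simp only [Finset.coe_filter, Finset.mem_univ, true_and, Set.mem_setOf_eq, Set.mem_inter_iff] at hω ⊢
    exact ⟨Ψ_mem_twoWorld ends s B X hω.1, trivialCore_Ψ ends s B X hω.2⟩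
  · intro ω hω ω' hω' h
    simp only [Finset.coe_filter, Finset.mem_univ, true_and, Set.mem_setOf_eq, Set.mem_inter_iff] at hω hω'
    exact Ψ_injOn ends s B X hω.2 hω.1 hω'.2 hω'.1 h

end ReimerVdBK

end Summit.Ventures.PercRepro2
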